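import Mathlib
import Summits.KontsevichZagierPeriods.KontsevichZagierPeriods.Theorems.TorsionLogsNeronTorsionSectorStubTranslationStep
import Summits.KontsevichZagierPeriods.KontsevichZagierPeriods.Theorems.TorsionLogsNeronTorsionSectorStubSigmaChart
import Summits.KontsevichZagierPeriods.KontsevichZagierPeriods.Theorems.SymplecticScissorsRealOnePeriodRelationsStubArcSymbolsCut
import Literature.NumberTheory.Transcendental.SemialgebraicLineDeriv
import Literature.NumberTheory.Transcendental.KZLogCalculusProofs
import HarnessLib

/-!
# Stub `stub_zeroStepInst` — crux `TorsionLogs.NeronTorsionSector`, line `registered` (block S3):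
# the up-step out of the corner row

On the identity component of the real cubic `y² = f(x) = 4x³ − g₂x − g₃` the row-0 half-cell of
the regular second-kind double integral is written in the compactifying chart `s = x^{-1/2}` at the
point at infinity (`s ∈ (0, s₁)`, `s₁² x₁ = 1`, `R s = s³√f(s⁻²) > 0` on `[0, s₁]`):
`T₀ = [{0 < s < s′ < s₁}, ĥ(s′)·(2/R s)·(2/R s′)]`, `ĥ(s) = h(s⁻²) = (g₂s² + 2g₃s⁴)/4`,
`h(x) = (g₂x + 2g₃)/(4x²)`. The row-1 half-cell in the `x`-chart is
`T₁ = [{x₂ < x′ < x < x₁}, h(x′)/(√f(x)√f(x′))]`, and the output of the step is the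
one-dimensional representation `rO = [(0, s₁), (Q̂(s₁) − Q̂(s))·2/R(s)]`, `Q̂(s) = Qf(s⁻²)` the chart
form of the third-kind potential. We prove `[T₁] − [T₀] − [rO] ∈ KZ.relations`.

This is ONE application of the landed generic translation step `stub_translationStep` with
`φ = ψ = τ̂` (the chart translation `(0, s₁) → (x₂, x₁)`, strictly decreasing, with the chart Haar
identity `|τ̂′|·R = 2√f∘τ̂`, i.e. `u(τ̂ s)|τ̂′ s| = w s` for the target weight `u = 1/√f` and the
source weight `w = 2/R`), kernels `kS = ĥ`, `kT = h` (both bounded by the bound `Cb` of `h` right of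
`x₂`, since `ĥ(s) = h(s⁻²)` and `s⁻² > x₁`), fibres `(s, s₁)`, and potential `Q = −Q̂`, whose
derivative `Q̂′ = (h∘τ̂ − ĥ)·2/R` on `(0, s₁)` is the chain rule applied to the `x`-chart identity
`Qf′ = (h∘τ − h)/(−√f)` at `x = s⁻² > x₁` (`d(s⁻²)/ds = −2/s³`, `√f(s⁻²) = R/s³`). The image identity
`(τ̂ × τ̂){0 < s < s′ < s₁} = {x₂ < x′ < x < x₁}` is strict anti-monotonicity of `τ̂` on `(0, s₁]` and
`τ̂((0, s₁)) = (x₂, x₁)`.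

References: M. Kontsevich, D. Zagier, *Periods* (2001), §1.2 rules (1)–(3); J. Bochnak, M. Coste,
M.-F. Roy, *Real Algebraic Geometry* (1998), §2.2, Prop. 2.2.6.
-/

noncomputable section

-- `Summit.KontsevichZagierPeriods.KontsevichZagierPeriods.…` is the tree's mandated layout (single-conjunct summit).
set_option linter.dupNamespace false

open Set MeasureTheory Filter Topology
open Literature.NumberTheory.Transcendental Literature.ModelTheory.ExponentialFields
open Summit.KontsevichZagierPeriods.SymplecticScissors.RealOnePeriodRelations.ArcSymbols
  (isSemialgebraic_IooDom)

namespace Summit.KontsevichZagierPeriods.KontsevichZagierPeriods.Cruxes.NeronTorsionSector.Translation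

/-- **Chain rule for the third-kind potential in the chart `s = x^{-1/2}` at infinity.** If
`Q̂ s = Qf(s⁻²)`, `τ̂ s = τ(s⁻²)` and `√f(s⁻²) = R s / s³` on `(0, s₁]`, `s₁² x₁ = 1`, `R > 0` on
`[0, s₁]`, and `Qf′(x) = (h(τ x) − h x)/(−√f x)` for `x > x₁` with `h(x) = (g₂x + 2g₃)/(4x²)`, then on
`(0, s₁)` the chart potential satisfies `Q̂′(s) = (h(τ̂ s) − ĥ s)·2/R s`, `ĥ(s) = (g₂s² + 2g₃s⁴)/4`
(`d(s⁻²)/ds = −2/s³`). [cite: KontsevichZagier2001, §1.2 rule (2)] -/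
theorem zeroStep_hasDerivAt_chart {g₂ g₃ x₁ s₁ : ℝ} {f τ Qf R τh Qh : ℝ → ℝ}
    (hsx : s₁ ^ 2 * x₁ = 1)
    (hchart : ∀ s, 0 < s → s ≤ s₁ →
      Real.sqrt (f (s ^ 2)⁻¹) = R s / s ^ 3 ∧ τh s = τ (s ^ 2)⁻¹ ∧ Qh s = Qf (s ^ 2)⁻¹)
    (hRpos : ∀ s ∈ Icc 0 s₁, 0 < R s)
    (hQfd : ∀ x, x₁ < x → HasDerivAt Qf
      (((g₂ * τ x + 2 * g₃) / (4 * τ x ^ 2) - (g₂ * x + 2 * g₃) / (4 * x ^ 2)) /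
        (-Real.sqrt (f x))) x)
    {s : ℝ} (hs : s ∈ Ioo 0 s₁) :
    HasDerivAt Qh (((g₂ * τh s + 2 * g₃) / (4 * τh s ^ 2) - (g₂ * s ^ 2 + 2 * g₃ * s ^ 4) / 4) *
      (2 / R s)) s := by
  have hs0 : 0 < s := hs.1
  have hx : x₁ < (s ^ 2)⁻¹ := sigmaChart_lt_inv_sq hsx hs0 hs.2
  obtain ⟨hsq, hτ, -⟩ := hchart s hs0 hs.2.le
  have hinner : HasDerivAt (fun y : ℝ => (y ^ 2)⁻¹) (-2 / s ^ 3) s :=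
    sigmaChart_hasDerivAt_inv_sq hs0.ne'
  have hcomp := (hQfd _ hx).comp s hinner
  have hev : Qh =ᶠ[𝓝 s] (Qf ∘ fun y : ℝ => (y ^ 2)⁻¹) := by
    filter_upwards [Ioo_mem_nhds hs.1 hs.2] with y hy
    exact (hchart y hy.1 hy.2.le).2.2
  refine (hcomp.congr_of_eventuallyEq hev).congr_deriv ?_
  have hR0 : R s ≠ 0 := (hRpos s ⟨hs0.le, hs.2.le⟩).ne'
  have hs0' : s ≠ 0 := hs0.ne'
  rw [← hτ, hsq]
  generalize (g₂ * τh s + 2 * g₃) / (4 * τh s ^ 2) = A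
  field_simp

/-- **STUB S3 (`stub_zeroStepInst`) — the up-step out of the corner row,
`t_1 ≡ t̂_0 + [(0,s₁), (q₁ − Q̂)·2/R]`.** Source: the row-0 half-cell in the chart `s = x^{-1/2}`,
`t̂_0 = [{0 < s < s′ < s₁}, ĥ(s′)·(2/R s)(2/R s′)]` (`ĥ(s) = h(s⁻²) = (g₂s² + 2g₃s⁴)/4`,
`R s = s³√f(s⁻²)`); target: the x-chart half-cell `t_1 = [{x₂ < x′ < x < x₁}, h(x′)/(√f√f′)]`; ONE
application of `stub_translationStep` with `φ = ψ = τ̂` (the chart translation, decreasing,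
`(0,s₁) → (x₂,x₁)`, chart Haar identity `|τ̂′|R = 2√f∘τ̂`), weights `w = 2/R`, `u = 1/√f`, kernels
`kS = ĥ`, `kT = h`, fibres `(s, s₁)`, potential `Q = −Q̂` (`Q̂ = Qf(s⁻²)`; chain rule from
`Qf′ = (h∘τ − h)/yb`: `Q̂′ = 2(h∘τ̂ − ĥ)/R`, `zeroStep_hasDerivAt_chart`), `Q̂(s₁) = Qf(x₁) = q₁`.
[cite: KontsevichZagier2001, §1.2] -/
theorem stub_zeroStepInst :
    ∀ (g₂ g₃ x₁ x₂ s₁ Cb : ℝ) (f τ Qf R τh τh' Qh : ℝ → ℝ)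
      (T0 T1 : Literature.NumberTheory.Transcendental.KZ.IntegralRep 2)
      (rO : Literature.NumberTheory.Transcendental.KZ.IntegralRep 1),
    (∀ x, f x = 4 * x ^ 3 - g₂ * x - g₃) → IsAlgebraic ℚ g₂ → IsAlgebraic ℚ g₃ →
    IsAlgebraic ℚ x₁ → IsAlgebraic ℚ x₂ → IsAlgebraic ℚ s₁ →
    0 < x₂ → x₂ < x₁ → 0 < s₁ → s₁ ^ 2 * x₁ = 1 → (∀ x, x₂ ≤ x → 0 < f x) →
    (∀ x, x₂ ≤ x → |(g₂ * x + 2 * g₃) / (4 * x ^ 2)| ≤ Cb) →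
    (∀ s, 0 < s → s ≤ s₁ → Real.sqrt (f (s ^ 2)⁻¹) = R s / s ^ 3 ∧ τh s = τ (s ^ 2)⁻¹ ∧ Qh s = Qf (s ^ 2)⁻¹) →
    (∀ s ∈ Set.Icc 0 s₁, 0 < R s) → ContinuousOn R (Set.Icc 0 s₁) →
    IsSemialgebraicFunOn ℚ {t : Fin 1 → ℝ | t 0 ∈ Set.Icc 0 s₁} (fun t => R (t 0)) →
    (∀ s ∈ Set.Ioo 0 s₁, HasDerivAt τh (τh' s) s ∧ |τh' s| * R s = 2 * Real.sqrt (f (τh s)) ∧ τh s ∈ Set.Ioo x₂ x₁) →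
    StrictAntiOn τh (Set.Ioc 0 s₁) → Set.InjOn τh (Set.Ioo 0 s₁) → τh '' Set.Ioo 0 s₁ = Set.Ioo x₂ x₁ →
    IsSemialgebraicFunOn ℚ {t : Fin 1 → ℝ | t 0 ∈ Set.Icc 0 s₁} (fun t => τh (t 0)) →
    ContinuousOn Qh (Set.Icc 0 s₁) →
    IsSemialgebraicFunOn ℚ {t : Fin 1 → ℝ | t 0 ∈ Set.Icc 0 s₁} (fun t => Qh (t 0)) →
    (∀ x, x₁ < x → HasDerivAt Qf
      (((g₂ * τ x + 2 * g₃) / (4 * τ x ^ 2) - (g₂ * x + 2 * g₃) / (4 * x ^ 2)) / (-Real.sqrt (f x))) x) →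
    T0.domain = {z | 0 < z 0 ∧ z 0 < z 1 ∧ z 1 < s₁} →
    Set.EqOn T0.integrand
      (fun z => (g₂ * (z 1) ^ 2 + 2 * g₃ * (z 1) ^ 4) / 4 * (2 / R (z 0)) * (2 / R (z 1))) T0.domain →
    T1.domain = {z | x₂ < z 1 ∧ z 1 < z 0 ∧ z 0 < x₁} →
    Set.EqOn T1.integrand
      (fun z => (g₂ * z 1 + 2 * g₃) / (4 * (z 1) ^ 2) / (Real.sqrt (f (z 0)) * Real.sqrt (f (z 1)))) T1.domain →
    rO.domain = {t | 0 < t 0 ∧ t 0 < s₁} →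
    Set.EqOn rO.integrand (fun t => (Qh s₁ - Qh (t 0)) * (2 / R (t 0))) rO.domain →
    Literature.NumberTheory.Transcendental.KZ.of T1 - Literature.NumberTheory.Transcendental.KZ.of T0
      - Literature.NumberTheory.Transcendental.KZ.of rO ∈ Literature.NumberTheory.Transcendental.KZ.relations := by
  intro g₂ g₃ x₁ x₂ s₁ Cb f τ Qf R τh τh' Qh T0 T1 rO hf h₂ h₃ hx₁a hx₂a hs₁a hx₂0 hx₂₁ _hs₁0 hsx hfpos
    hCb hchart hRpos hRc hRσ hτh hanti hinj hτimg hτσ hQhc hQhσ hQfd hT0d hT0i hT1d hT1i hOd hOi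
  /- ## Pointwise facts -/
  have hIooIcc : Ioo 0 s₁ ⊆ Icc 0 s₁ := Ioo_subset_Icc_self
  have hIooIoc : Ioo 0 s₁ ⊆ Ioc 0 s₁ := Ioo_subset_Ioc_self
  have hRne : ∀ s ∈ Ioo 0 s₁, R s ≠ 0 := fun s hs => (hRpos s (hIooIcc hs)).ne'
  have hτI : ∀ s ∈ Ioo 0 s₁, τh s ∈ Ioo x₂ x₁ := fun s hs => (hτh s hs).2.2
  have hsqrt_pos : ∀ x ∈ Ioo x₂ x₁, 0 < Real.sqrt (f x) := fun x hx =>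
    Real.sqrt_pos.2 (hfpos x hx.1.le)
  /- ## The semialgebraic sets `A = B = (0, s₁)`, `A′ = B′ = (x₂, x₁)`, `J = [0, s₁]` -/
  have hA : IsSemialgebraic ℚ {t : Fin 1 → ℝ | t 0 ∈ Ioo 0 s₁} :=
    isSemialgebraic_IooDom isAlgebraic_zero hs₁a
  have hA' : IsSemialgebraic ℚ {t : Fin 1 → ℝ | t 0 ∈ Ioo x₂ x₁} :=
    isSemialgebraic_IooDom hx₂a hx₁a
  have hJ : IsSemialgebraic ℚ {t : Fin 1 → ℝ | t 0 ∈ Icc 0 s₁} :=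
    IsSemialgebraicFunOn.isSemialgebraic_holds hRσ
  have hAJ : {t : Fin 1 → ℝ | t 0 ∈ Ioo 0 s₁} ⊆ {t : Fin 1 → ℝ | t 0 ∈ Icc 0 s₁} :=
    fun t ht => hIooIcc ht
  /- ## Semialgebraic functions on `A`: `τ̂`, `R`, the weight `2/R`, the fibre ends, the kernel `ĥ` -/
  have hτS : IsSemialgebraicFunOn ℚ {t : Fin 1 → ℝ | t 0 ∈ Ioo 0 s₁} (fun t => τh (t 0)) :=
    hτσ.mono hAJ hA
  have hRS : IsSemialgebraicFunOn ℚ {t : Fin 1 → ℝ | t 0 ∈ Ioo 0 s₁} (fun t => R (t 0)) :=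
    hRσ.mono hAJ hA
  have hwS : IsSemialgebraicFunOn ℚ {t : Fin 1 → ℝ | t 0 ∈ Ioo 0 s₁} (fun t => 2 / R (t 0)) :=
    (isSemialgebraicFunOn_const_ofNat hA 2).div hRS fun t ht => hRne (t 0) ht
  have hX : IsSemialgebraicFunOn ℚ {t : Fin 1 → ℝ | t 0 ∈ Ioo 0 s₁} (fun t => t 0) :=
    (isSemialgebraicFunOn_aeval hA (MvPolynomial.X 0)).congr fun t _ => by simp
  have hdS : IsSemialgebraicFunOn ℚ {t : Fin 1 → ℝ | t 0 ∈ Ioo 0 s₁} (fun _ => s₁) :=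
    isSemialgebraicFunOn_const_of_isAlgebraic hA hs₁a
  have hkS : IsSemialgebraicFunOn ℚ {t : Fin 1 → ℝ | t 0 ∈ Ioo 0 s₁}
      (fun t => (g₂ * (t 0) ^ 2 + 2 * g₃ * (t 0) ^ 4) / 4) :=
    (((isSemialgebraicFunOn_const_of_isAlgebraic hA h₂).fun_mul (hX.fun_pow 2)).fun_add
      (((isSemialgebraicFunOn_const_ofNat hA 2).fun_mul
        (isSemialgebraicFunOn_const_of_isAlgebraic hA h₃)).fun_mul (hX.fun_pow 4))).div
      (isSemialgebraicFunOn_const_ofNat hA 4) fun _ _ => four_ne_zero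
  /- ## Semialgebraic functions on `A′`: the weight `1/√f` and the kernel `h` -/
  have huS : IsSemialgebraicFunOn ℚ {t : Fin 1 → ℝ | t 0 ∈ Ioo x₂ x₁}
      (fun t => (Real.sqrt (f (t 0)))⁻¹) :=
    (isSemialgebraicFunOn_sqrt_cubic_apply hA' h₂ h₃ hf 0).inv fun t ht => (hsqrt_pos (t 0) ht).ne'
  have hX' : IsSemialgebraicFunOn ℚ {t : Fin 1 → ℝ | t 0 ∈ Ioo x₂ x₁} (fun t => t 0) :=
    (isSemialgebraicFunOn_aeval hA' (MvPolynomial.X 0)).congr fun t _ => by simp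
  have hkT : IsSemialgebraicFunOn ℚ {t : Fin 1 → ℝ | t 0 ∈ Ioo x₂ x₁}
      (fun t => (g₂ * t 0 + 2 * g₃) / (4 * (t 0) ^ 2)) :=
    (((isSemialgebraicFunOn_const_of_isAlgebraic hA' h₂).fun_mul hX').fun_add
      ((isSemialgebraicFunOn_const_ofNat hA' 2).fun_mul
        (isSemialgebraicFunOn_const_of_isAlgebraic hA' h₃))).div
      ((isSemialgebraicFunOn_const_ofNat hA' 4).fun_mul (hX'.fun_pow 2)) fun t ht =>
        mul_ne_zero four_ne_zero (pow_ne_zero 2 (hx₂0.trans ht.1).ne')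
  /- ## Bounds, signs, integrability -/
  have hkSb : ∀ s ∈ Ioo 0 s₁, |(g₂ * s ^ 2 + 2 * g₃ * s ^ 4) / 4| ≤ Cb := fun s hs => by
    have hx : x₁ < (s ^ 2)⁻¹ := sigmaChart_lt_inv_sq hsx hs.1 hs.2
    have h := hCb (s ^ 2)⁻¹ (hx₂₁.trans hx).le
    have hs0 : s ≠ 0 := hs.1.ne'
    have e : (g₂ * (s ^ 2)⁻¹ + 2 * g₃) / (4 * ((s ^ 2)⁻¹) ^ 2) =
        (g₂ * s ^ 2 + 2 * g₃ * s ^ 4) / 4 := by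
      field_simp
    rwa [e] at h
  have hkTb : ∀ x ∈ Ioo x₂ x₁, |(g₂ * x + 2 * g₃) / (4 * x ^ 2)| ≤ Cb := fun x hx => hCb x hx.1.le
  have hwnn : ∀ s ∈ Ioo 0 s₁, 0 ≤ 2 / R s := fun s hs =>
    div_nonneg zero_le_two (hRpos s (hIooIcc hs)).le
  have hwint : IntegrableOn (fun s => 2 / R s) (Ioo 0 s₁) := by
    have hc : ContinuousOn (fun s => 2 / R s) (Icc 0 s₁) :=
      continuousOn_const.div hRc fun s hs => (hRpos s hs).ne'
    exact hc.integrableOn_Icc.mono_set Ioo_subset_Icc_self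
  /- ## The chart translation: derivative and the chart Haar identity `(1/√f∘τ̂)·|τ̂′| = 2/R` -/
  have hder : ∀ s ∈ Ioo 0 s₁,
      HasDerivAt τh (τh' s) s ∧ (Real.sqrt (f (τh s)))⁻¹ * |τh' s| = 2 / R s := fun s hs => by
    obtain ⟨hd, hhaar, hmem⟩ := hτh s hs
    refine ⟨hd, ?_⟩
    have h1 : Real.sqrt (f (τh s)) ≠ 0 := (hsqrt_pos _ hmem).ne'
    have h2 : R s ≠ 0 := hRne s hs
    field_simp
    linear_combination hhaar
  have hmaps : MapsTo τh (Ioo 0 s₁) (Ioo x₂ x₁) := fun s hs => hτI s hs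
  /- ## The fibres `(s, s₁)` -/
  have hcd : ∀ s ∈ Ioo 0 s₁, s < s₁ := fun s hs => hs.2
  have hJcd : ∀ s ∈ Ioo 0 s₁, Icc s s₁ ⊆ Icc 0 s₁ := fun s hs => Icc_subset_Icc_left hs.1.le
  have hBcd : ∀ s ∈ Ioo 0 s₁, Ioo s s₁ ⊆ Ioo 0 s₁ := fun s hs => Ioo_subset_Ioo_left hs.1.le
  /- ## The potential `Q = −Q̂` -/
  have hQS : IsSemialgebraicFunOn ℚ {t : Fin 1 → ℝ | t 0 ∈ Icc 0 s₁} (fun t => -Qh (t 0)) :=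
    hQhσ.fun_neg
  have hQc : ∀ s ∈ Ioo 0 s₁, ContinuousOn (fun x => -Qh x) (Icc s s₁) := fun s hs =>
    (hQhc.mono (hJcd s hs)).neg
  have hQd : ∀ s ∈ Ioo 0 s₁, ∀ s' ∈ Ioo s s₁, HasDerivAt (fun x => -Qh x)
      (-(((g₂ * τh s' + 2 * g₃) / (4 * τh s' ^ 2) - (g₂ * s' ^ 2 + 2 * g₃ * s' ^ 4) / 4) *
        (2 / R s'))) s' :=
    fun s hs s' hs' => (zeroStep_hasDerivAt_chart hsx hchart hRpos hQfd (hBcd s hs hs')).neg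
  /- ## Domains and integrands of the three given representations -/
  have hSd : T0.domain = {z | z 0 ∈ Ioo 0 s₁ ∧ z 0 < z 1 ∧ z 1 < s₁} := by
    rw [hT0d]
    ext z
    simp only [mem_setOf_eq, mem_Ioo]
    constructor
    · rintro ⟨h0, h01, h1⟩
      exact ⟨⟨h0, h01.trans h1⟩, h01, h1⟩
    · rintro ⟨⟨h0, -⟩, h01, h1⟩
      exact ⟨h0, h01, h1⟩
  have hTd : T1.domain = (fun z : Fin 2 → ℝ => (![τh (z 0), τh (z 1)] : Fin 2 → ℝ)) '' T0.domain := by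
    rw [hT1d, hT0d]
    ext w
    simp only [mem_setOf_eq, mem_image]
    constructor
    · rintro ⟨h1, h10, h0⟩
      have hw0 : w 0 ∈ τh '' Ioo 0 s₁ := by
        rw [hτimg]
        exact ⟨h1.trans h10, h0⟩
      have hw1 : w 1 ∈ τh '' Ioo 0 s₁ := by
        rw [hτimg]
        exact ⟨h1, h10.trans h0⟩
      obtain ⟨a, ha, hwa⟩ := hw0
      obtain ⟨b, hb, hwb⟩ := hw1
      have hab : a < b := by
        rw [← hwa, ← hwb] at h10
        exact (hanti.lt_iff_gt (hIooIoc hb) (hIooIoc ha)).1 h10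
      refine ⟨![a, b], ⟨?_, ?_, ?_⟩, ?_⟩
      · simpa using ha.1
      · simpa using hab
      · simpa using hb.2
      · ext i
        fin_cases i
        · simpa using hwa
        · simpa using hwb
    · rintro ⟨z, ⟨h0, h01, h1⟩, rfl⟩
      have hz0 : z 0 ∈ Ioo 0 s₁ := ⟨h0, h01.trans h1⟩
      have hz1 : z 1 ∈ Ioo 0 s₁ := ⟨h0.trans h01, h1⟩
      simp only [Matrix.cons_val_zero, Matrix.cons_val_one]
      exact ⟨(hτI _ hz1).1, hanti (hIooIoc hz0) (hIooIoc hz1) h01, (hτI _ hz0).2⟩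
  have hTi : EqOn T1.integrand (fun z => (g₂ * z 1 + 2 * g₃) / (4 * (z 1) ^ 2) *
      (Real.sqrt (f (z 0)))⁻¹ * (Real.sqrt (f (z 1)))⁻¹) T1.domain := by
    intro z hz
    rw [hT1i hz]
    ring
  have hOd' : rO.domain = {t | t 0 ∈ Ioo 0 s₁} := by
    rw [hOd]
    rfl
  have hOi' : EqOn rO.integrand (fun t => (-Qh (t 0) - -Qh s₁) * (2 / R (t 0))) rO.domain := by
    intro t ht
    rw [hOi ht]
    ring
  /- ## One application of the translation step -/
  exact stub_translationStep τh τh' τh τh' (fun s => (g₂ * s ^ 2 + 2 * g₃ * s ^ 4) / 4)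
    (fun x => (g₂ * x + 2 * g₃) / (4 * x ^ 2)) (fun s => 2 / R s) (fun s => 2 / R s)
    (fun x => (Real.sqrt (f x))⁻¹) (fun x => (Real.sqrt (f x))⁻¹) (fun x => -Qh x) (fun s => s)
    (fun _ => s₁) (Ioo 0 s₁) (Ioo 0 s₁) (Ioo x₂ x₁) (Ioo x₂ x₁) (Icc 0 s₁) Cb T0 T1 rO hA hA hA' hA'
    hJ hτS hτS hinj hinj hmaps hmaps hder hder hwS hwS huS huS hkS hkT hkSb hkTb hwnn hwnn hwint
    hwint hX hdS hcd hJcd hBcd hQS hQc hQd hSd hT0i hTd hTi hOd' hOi'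

end Summit.KontsevichZagierPeriods.KontsevichZagierPeriods.Cruxes.NeronTorsionSector.Translation

end
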